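import Mathlib
import Summits.PneNP.PneNP.Theorems.CnfIdealGenLengthRankDefectRepresentationsCutLemma

/-!
# Crux `RankDefectRepresentations` (stmt-PneNP-18923), line `rank-dehn-ladder`: ESSENTIAL ROWS of a one-family instance — at most
# `mc` per colour (lead g12)

A ONE-FAMILY INSTANCE is a matrix `R` whose rows and columns carry colours (`row`, `col` into a type `Q`); the entry `(x,y)` is VISIBLE iff
`row x ≠ col y`, and a COMPLETION is any matrix agreeing with `R` at the visible entries (g7's max-cut decomposition
`…CutLemma.exists_blockDiagonal_of_maxCut` bounds the minimal completion rank `mc` by four times the maximal bipartition cut).  A row `t` is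
ESSENTIAL if deleting it lowers the minimal completion rank.  The single-family max-cut scheme for the crux's tool stub `stub_coreLinear`
(memo `Cruxes/RankDefectRepresentations/Lines/rank-dehn-ladder-g12.md` §1, §9) needs, after every cut currency was refuted (memo §2, §8),
an accounting in `mc` itself, i.e. a bound on essential rows; conjecture (E) of the memo is `#essential ≤ 2·mc − 1` (tight).  THIS FILE
proves the per-colour case, stated without any definition of `mc`: if every completion of `R` has rank `≥ m` and `t_1, …, t_N` are
distinct rows OF ONE COLOUR each of whose deletion admits a completion of rank `< m`, then `N ≤ m` (`essentialRows_oneColour_le`).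
Proof: the deletion witnesses `L_i` give subspaces `W_i = rowspace(L_i ∘ 1[col ≠ h])` of dimension `< m` containing the visible parts of all
`t_j`, `j ≠ i`, but not that of `t_i` (else replacing row `t_i` of `L_i` by the combination is a completion of rank `< m`); so the visible
parts are linearly independent and `N − 1` of them lie in `W_1`.
HONEST FRAMING: elementary; a helper (`--supports`) for the crux; the registered stubs are untouched; P ≠ NP is not moved; F-N2 is a
FRONTIER formal rung.
-/

set_option linter.dupNamespace false -- `Summit.PneNP.PneNP.…`: summit = sub-problem name (D-0017)

namespace Summit.PneNP.PneNP.Theorems.CnfIdealGenLengthRankDefectRepresentationsEssentialRows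

open Matrix Module

variable {K : Type} [Field K] {ι ι' Q : Type} [Fintype ι] [Fintype ι'] [DecidableEq ι] [DecidableEq ι']

/-- **At most `mc` essential rows of any one colour.**  If every completion of the one-family instance `R` (agreement wherever
`row x ≠ col y`) has rank `≥ m`, and `t : Fin N → ι` are distinct rows of a common colour `h`, each admitting after its deletion a
completion of rank `< m`, then `N ≤ m`. -/
theorem essentialRows_oneColour_le (row : ι → Q) (col : ι' → Q) (R : Matrix ι ι' K) (m : ℕ)
    (hmin : ∀ L : Matrix ι ι' K, (∀ x y, row x ≠ col y → L x y = R x y) → m ≤ L.rank)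
    {N : ℕ} (t : Fin N → ι) (ht : Function.Injective t) (h : Q) (hcolour : ∀ i, row (t i) = h)
    (hess : ∀ i, ∃ L : Matrix ι ι' K, (∀ x y, x ≠ t i → row x ≠ col y → L x y = R x y) ∧ L.rank < m) :
    N ≤ m := by
  classical
  rcases Nat.eq_zero_or_pos N with hN | hN
  · omega
  choose L hLagree hLrank using hess
  -- the visible parts of the rows `t j`, zero-padded on the columns of colour `h`
  set u : Fin N → (ι' → K) := fun j y => if col y ≠ h then R (t j) y else 0 with hu
  -- the column mask killing colour `h`
  set Dm : Matrix ι' ι' K := Matrix.diagonal fun y => if col y ≠ h then (1 : K) else 0 with hDm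
  have mask_apply : ∀ (A : Matrix ι ι' K) x y, (A * Dm) x y = if col y ≠ h then A x y else 0 := by
    intro A x y
    simp only [hDm, Matrix.mul_diagonal]
    split_ifs <;> simp
  -- the witness subspaces
  set W : Fin N → Submodule K (ι' → K) := fun i => Submodule.span K (Set.range (L i * Dm).row) with hW
  have hWdim : ∀ i, finrank K (W i) < m := by
    intro i
    have : finrank K (W i) = (L i * Dm).rank := (Matrix.rank_eq_finrank_span_row _).symm
    rw [this]
    exact lt_of_le_of_lt (Matrix.rank_mul_le_left _ _) (hLrank i)
  -- (A) `u j ∈ W i` for `j ≠ i`: it is the row `t j` of `L i * Dm`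
  have memA : ∀ i j, j ≠ i → u j ∈ W i := by
    intro i j hji
    have e : u j = (L i * Dm).row (t j) := by
      funext y
      simp only [hu, Matrix.row_apply, mask_apply]
      by_cases hy : col y ≠ h
      · rw [if_pos hy, if_pos hy, hLagree i (t j) y (fun h' => hji (ht h')) (by rw [hcolour j]; exact fun e => hy e.symm)]
      · rw [if_neg hy, if_neg hy]
    rw [e]
    exact Submodule.subset_span ⟨t j, rfl⟩
  -- (B) `u i ∉ W i`: otherwise replacing row `t i` of `L i` by the combination is a cheap completion
  have notMemB : ∀ i, u i ∉ W i := by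
    intro i hmem
    -- write `u i` as `cvec ᵥ* (L i * Dm)`
    have hmem' : u i ∈ Submodule.span K (Set.range (L i * Dm).row) := hmem
    rw [Submodule.mem_span_range_iff_exists_fun] at hmem'
    obtain ⟨cvec, hc⟩ := hmem'
    set L' : Matrix ι ι' K := (1 : Matrix ι ι K).updateRow (t i) cvec * L i with hL'
    have hL'row : ∀ x y, L' x y = if x = t i then (cvec ᵥ* L i) y else L i x y := by
      intro x y
      rw [hL', Matrix.updateRow_mul, Matrix.one_mul]
      by_cases hx : x = t i
      · subst hx; simp
      · simp [hx]
    have hcomb : ∀ y, col y ≠ h → (cvec ᵥ* L i) y = R (t i) y := by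
      intro y hy
      have h1 := congrFun hc y
      simp only [Finset.sum_apply, Pi.smul_apply, smul_eq_mul, Matrix.row_apply, mask_apply, if_pos hy] at h1
      have h2 : u i y = R (t i) y := by simp [hu, hy]
      rw [← h2, ← h1]
      simp only [Matrix.vecMul, dotProduct]
    have hagree : ∀ x y, row x ≠ col y → L' x y = R x y := by
      intro x y hxy
      rw [hL'row]
      by_cases hx : x = t i
      · rw [if_pos hx]
        subst hx
        exact hcomb y (by rw [hcolour i] at hxy; exact fun e => hxy e.symm)
      · rw [if_neg hx]
        exact hLagree i x y hx hxy
    have hrank : L'.rank < m := lt_of_le_of_lt (Matrix.rank_mul_le_right _ _) (hLrank i)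
    exact absurd (hmin L' hagree) (not_le.mpr hrank)
  -- (C) hence the `u j` are linearly independent and `N − 1` of them lie in `W i₀`
  obtain ⟨i₀⟩ : Nonempty (Fin N) := ⟨⟨0, hN⟩⟩
  have hli : LinearIndependent K (fun j : {j : Fin N // j ≠ i₀} => u j.1) := by
    rw [linearIndependent_iff_notMem_span]
    intro j hmem
    apply notMemB j.1
    refine Submodule.span_le.mpr ?_ hmem
    rintro _ ⟨j', hj', rfl⟩
    have hne : (j' : Fin N) ≠ j.1 := by
      intro e
      apply hj'.2
      simp only [Set.mem_singleton_iff]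
      exact Subtype.ext e
    exact memA j.1 j'.1 hne
  have hspan_le : Submodule.span K (Set.range fun j : {j : Fin N // j ≠ i₀} => u j.1) ≤ W i₀ := by
    refine Submodule.span_le.mpr ?_
    rintro _ ⟨j, rfl⟩
    exact memA i₀ j.1 j.2
  have hcard : Fintype.card {j : Fin N // j ≠ i₀} ≤ finrank K (W i₀) := by
    rw [← finrank_span_eq_card hli]
    exact Submodule.finrank_mono hspan_le
  have hc2 : Fintype.card {j : Fin N // j ≠ i₀} = N - 1 := by
    simp [Fintype.card_subtype_compl, Fintype.card_fin]
  have := hWdim i₀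
  omega

end Summit.PneNP.PneNP.Theorems.CnfIdealGenLengthRankDefectRepresentationsEssentialRows
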